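import Literature.MathematicalPhysics.KineticTheory.SiteChainFokkerPlanckDefect
import HarnessLib

/-!
# Fokker–Planck identification for site-inhomogeneous chains, V: truncations with small defect

Topic `Literature/MathematicalPhysics/KineticTheory`, grouping namespace `…KineticTheory.HeatConduction`.
The three terms of the `L¹` bound `integral_abs_defect_le` (`SiteChainFokkerPlanckDefect.lean`) are made
small: `∫ θ_M(ρ) → 0` (`M → ∞`), `∫ 1_{R ≤ H} ρ → 0` (`R → ∞`), and — when the energy sublevel
sets have polynomially growing volume `|{H ≤ 4R}| ≤ C R^d` — the cross term with
`δ = 1/(1 + |{H ≤ 4R}|)`, `ε = W^{-1/2}` is `O(√(W/R))`, `W = 1 + arsinh²(2M(1 + |{H ≤ 4R}|)) = O(log² R)`.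
Result (`exists_truncation_defect_le`): for a uniformly confining site-dependent chain, `N ≥ 1`,
`T_L, T_R ≥ 0`, a `C²` integrable solution `ρ ≥ 0` of `L̂ρ + 2γρ = 0` and every `η > 0`, `M₀, R₀`
there are `M ≥ M₀`, `R ≥ R₀` with `∫ |L̂ f_{R,M} + 2γ f_{R,M}| ≤ η`.

Also the elementary limits (dominated convergence on a general measure space; `log² R / R → 0`).
Twin of `Summits/…/EmbeddedDrudeMourreNessUniqueApproximation.lean` for site-dependent data.

## References

* N. Cuneo, J.-P. Eckmann, M. Hairer, L. Rey-Bellet, Electron. J. Probab. **23** (2018) no. 55, §3.1.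
-/

noncomputable section

open MeasureTheory Filter Topology Set
open scoped ContDiff NNReal ENNReal

namespace Literature.MathematicalPhysics.KineticTheory.HeatConduction

open Literature.MathematicalPhysics.KineticTheory

/-! ### Elementary limits for the removal of the truncations -/

section Limits

variable {α : Type*} [MeasurableSpace α] {μ : Measure α}

/-- `∫ θ_M(ρ) dμ → 0` as `M → ∞` for a measurable integrable `ρ` on any measure space
(`θ_M(s) = s[M < s]`; dominated convergence). [folklore] -/
theorem tendsto_integral_ite_lt_atTop {ρ : α → ℝ} (hρm : Measurable ρ) (hρi : Integrable ρ μ) :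
    Tendsto (fun M : ℝ => ∫ x, (if M < ρ x then ρ x else 0) ∂μ) atTop (𝓝 0) := by
  have h := tendsto_integral_filter_of_dominated_convergence (l := atTop)
    (F := fun (M : ℝ) (x : α) => if M < ρ x then ρ x else 0) (f := fun _ => (0 : ℝ))
    (μ := μ) (fun x => |ρ x|) ?_ ?_ hρi.abs ?_
  · simpa using h
  · refine Eventually.of_forall fun M => ?_
    have e : (fun x => (if M < ρ x then ρ x else 0)) = {x | M < ρ x}.indicator ρ := by
      funext x; simp only [Set.indicator_apply, Set.mem_setOf_eq]
    rw [e]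
    exact (hρi.indicator (measurableSet_lt measurable_const hρm)).aestronglyMeasurable
  · refine Eventually.of_forall fun M => Eventually.of_forall fun x => ?_
    split_ifs
    · exact le_of_eq (Real.norm_eq_abs _)
    · simp
  · refine Eventually.of_forall fun x => ?_
    refine tendsto_const_nhds.congr' ?_
    filter_upwards [eventually_ge_atTop (ρ x)] with M hM
    rw [if_neg (not_lt.2 hM)]

/-- `∫ 1_{R ≤ H} ρ dμ → 0` as `R → ∞` for integrable `ρ` and measurable `H` on any measure space.
[folklore] -/
theorem tendsto_integral_indicator_le_atTop {H : α → ℝ} (hH : Measurable H) {ρ : α → ℝ}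
    (hρi : Integrable ρ μ) :
    Tendsto (fun R : ℝ => ∫ x, {x | R ≤ H x}.indicator ρ x ∂μ) atTop (𝓝 0) := by
  have h := tendsto_integral_filter_of_dominated_convergence (l := atTop)
    (F := fun (R : ℝ) (x : α) => {x | R ≤ H x}.indicator ρ x) (f := fun _ => (0 : ℝ))
    (μ := μ) (fun x => |ρ x|) ?_ ?_ hρi.abs ?_
  · simpa using h
  · exact Eventually.of_forall fun R =>
      (hρi.indicator (measurableSet_le measurable_const hH)).aestronglyMeasurable
  · exact Eventually.of_forall fun R => Eventually.of_forall fun x =>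
      (norm_indicator_le_norm_self _ _).trans_eq (Real.norm_eq_abs _)
  · refine Eventually.of_forall fun x => tendsto_const_nhds.congr' ?_
    filter_upwards [eventually_gt_atTop (H x)] with R hR
    rw [Set.indicator_of_notMem]
    simp only [Set.mem_setOf_eq, not_le]
    exact hR

/-- **The logarithmic weight is negligible**: if `0 ≤ V(R) ≤ C R^d` for `R ≥ 1` then, for `M > 0`,
`√((1 + arsinh²(2M(1 + V(R)))) / R) → 0` as `R → ∞` (`arsinh x ≤ log(1 + 2x)`, `log² R / R → 0`).
[folklore] -/
theorem tendsto_sqrt_weight_div_atTop {M C : ℝ} (hM : 0 < M) (hC : 0 ≤ C) (d : ℕ) {V : ℝ → ℝ}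
    (hV0 : ∀ R, 1 ≤ R → 0 ≤ V R) (hV : ∀ R, 1 ≤ R → V R ≤ C * R ^ d) :
    Tendsto (fun R : ℝ => Real.sqrt ((1 + Real.arsinh (2 * M * (1 + V R)) ^ 2) / R)) atTop (𝓝 0) := by
  -- `arsinh x ≤ log (1 + 2x)` for `x ≥ 0`
  have harsinh : ∀ {x : ℝ}, 0 ≤ x → Real.arsinh x ≤ Real.log (1 + 2 * x) := fun {x} hx => by
    rw [Real.arsinh]
    refine Real.log_le_log (by positivity) ?_
    have h : Real.sqrt (1 + x ^ 2) ≤ 1 + x := by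
      rw [Real.sqrt_le_left (by linarith)]
      nlinarith
    linarith
  -- `log² R / R → 0`
  have hlog : Tendsto (fun R : ℝ => Real.log R ^ 2 / R) atTop (𝓝 0) := by
    have h := (isLittleO_log_rpow_rpow_atTop (2 : ℝ) (zero_lt_one)).tendsto_div_nhds_zero
    refine h.congr' ?_
    filter_upwards [eventually_ge_atTop (0 : ℝ)] with R hR
    rw [Real.rpow_two, Real.rpow_one]
  set A := Real.log (1 + 4 * M * (1 + C)) with hA
  have hA0 : 0 ≤ A := Real.log_nonneg (by nlinarith)
  -- comparison `W_R ≤ 1 + 2A² + 2 d² log² R` for `R ≥ 1`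
  have hcmp : ∀ R : ℝ, 1 ≤ R → (1 + Real.arsinh (2 * M * (1 + V R)) ^ 2) / R ≤
      (1 + 2 * A ^ 2) / R + 2 * (d : ℝ) ^ 2 * (Real.log R ^ 2 / R) := by
    intro R hR
    have hR0 : 0 < R := by linarith
    have hVR := hV R hR
    have hV0R := hV0 R hR
    have hx0 : 0 ≤ 2 * M * (1 + V R) := by positivity
    have hRd : 1 ≤ R ^ d := one_le_pow₀ hR
    have h1 : Real.arsinh (2 * M * (1 + V R)) ≤ A + d * Real.log R := by
      refine (harsinh hx0).trans ?_
      have hle : 1 + 2 * (2 * M * (1 + V R)) ≤ (1 + 4 * M * (1 + C)) * R ^ d := by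
        nlinarith [mul_nonneg hM.le hV0R, mul_nonneg hM.le hC, mul_nonneg (mul_nonneg hM.le hC) (sub_nonneg.2 hRd),
          mul_nonneg hM.le (sub_nonneg.2 hRd)]
      calc Real.log (1 + 2 * (2 * M * (1 + V R))) ≤ Real.log ((1 + 4 * M * (1 + C)) * R ^ d) :=
            Real.log_le_log (by positivity) hle
        _ = A + d * Real.log R := by
            rw [Real.log_mul (by positivity) (by positivity), Real.log_pow, hA]
    have h0 : 0 ≤ Real.arsinh (2 * M * (1 + V R)) := Real.arsinh_nonneg_iff.2 hx0
    have h2 : Real.arsinh (2 * M * (1 + V R)) ^ 2 ≤ 2 * A ^ 2 + 2 * (d : ℝ) ^ 2 * Real.log R ^ 2 := by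
      have := pow_le_pow_left₀ h0 h1 2
      nlinarith [sq_nonneg (A - d * Real.log R)]
    have e : (1 + 2 * A ^ 2) / R + 2 * (d : ℝ) ^ 2 * (Real.log R ^ 2 / R) =
        (1 + 2 * A ^ 2 + 2 * (d : ℝ) ^ 2 * Real.log R ^ 2) / R := by
      field_simp
    rw [e]
    exact div_le_div_of_nonneg_right (by linarith) hR0.le
  have hlim : Tendsto (fun R : ℝ => (1 + 2 * A ^ 2) / R + 2 * (d : ℝ) ^ 2 * (Real.log R ^ 2 / R))
      atTop (𝓝 0) := by
    have t1 : Tendsto (fun R : ℝ => (1 + 2 * A ^ 2) / R) atTop (𝓝 0) :=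
      tendsto_const_nhds.div_atTop tendsto_id
    have t2 := hlog.const_mul (2 * (d : ℝ) ^ 2)
    simpa using t1.add t2
  have hW : Tendsto (fun R : ℝ => (1 + Real.arsinh (2 * M * (1 + V R)) ^ 2) / R) atTop (𝓝 0) := by
    refine tendsto_of_tendsto_of_tendsto_of_le_of_le' tendsto_const_nhds hlim ?_ ?_
    · filter_upwards [eventually_ge_atTop (1 : ℝ)] with R hR
      positivity
    · filter_upwards [eventually_ge_atTop (1 : ℝ)] with R hR
      exact hcmp R hR
  have := hW.sqrt
  rwa [Real.sqrt_zero] at this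

end Limits

/-! ### Truncations with arbitrarily small stationary defect -/

namespace SiteChain.UniformlyConfining

variable {N : ℕ} {P : SiteChain} (hP : P.UniformlyConfining) (hN : 0 < N) {T_L T_R : ℝ} (hTL : 0 ≤ T_L)
  (hTR : 0 ≤ T_R) {ρ : PhaseSpace N → ℝ} (hρ : ContDiff ℝ 2 ρ) (hρ0 : ∀ x, 0 ≤ ρ x) (hρi : Integrable ρ)
  (hpde : ∀ x, sdeGenerator (fun y => -P.langevinDrift N y) (P.noiseVecL N T_L) (P.noiseVecR N T_R) ρ x +
    2 * P.γ * ρ x = 0)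
  (hvol : ∃ (C : ℝ) (d : ℕ), 0 ≤ C ∧ ∀ R : ℝ, 1 ≤ R →
    (volume {x : PhaseSpace N | P.hamiltonian N x ≤ 4 * R}).toReal ≤ C * R ^ d)
include hP hN hTL hTR hρ hρ0 hρi hpde hvol

/-- **Truncations with arbitrarily small stationary defect** (site-dependent chain with
polynomial volume growth of the energy sublevel sets). For every `η > 0` and all `M₀, R₀` there
are `M ≥ M₀`, `R ≥ R₀` (`M > 0`, `R ≥ 1`) such that `f = χ(H/R) · M φ(ρ/M)` satisfies
`∫ |L̂ f + 2γ f| ≤ η`. [folklore] -/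
theorem exists_truncation_defect_le {η : ℝ} (hη : 0 < η) (M₀ R₀ : ℝ) :
    ∃ M R : ℝ, M₀ ≤ M ∧ R₀ ≤ R ∧ 0 < M ∧ 1 ≤ R ∧
      ∫ x, |sdeGenerator (fun y => -P.langevinDrift N y) (P.noiseVecL N T_L) (P.noiseVecR N T_R)
            (fun y => smoothCutoff (P.hamiltonian N y / R) * (M * linCutoff (ρ y / M))) x +
          2 * P.γ * (smoothCutoff (P.hamiltonian N x / R) * (M * linCutoff (ρ x / M)))| ≤ η := by
  obtain ⟨K₀, K₃, K₄, hK₀, hK₃, hK₄, hbound⟩ := hP.integral_abs_defect_le hN hTL hTR hρ hρ0 hρi hpde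
  obtain ⟨Cv, d, hCv, hvolR⟩ := hvol
  have hHc : Continuous (P.hamiltonian N) := (hP.contDiff_hamiltonian N).continuous
  set m₀ := ∫ x, ρ x with hm₀
  have hm₀0 : 0 ≤ m₀ := integral_nonneg hρ0
  -- Step 1: the height
  have h1 : ∀ᶠ M : ℝ in atTop, K₀ * ∫ x, (if M < ρ x then ρ x else 0) ≤ η / 3 := by
    have t := (tendsto_integral_ite_lt_atTop (μ := volume) hρ.continuous.measurable hρi).const_mul K₀
    rw [mul_zero] at t
    exact (t.eventually (ge_mem_nhds (by positivity : (0:ℝ) < η / 3)))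
  obtain ⟨M, hM1, hMM₀, hM0⟩ : ∃ M, K₀ * ∫ x, (if M < ρ x then ρ x else 0) ≤ η / 3 ∧ M₀ ≤ M ∧ 0 < M := by
    obtain ⟨M, hM⟩ := (h1.and ((eventually_ge_atTop M₀).and (eventually_gt_atTop 0))).exists
    exact ⟨M, hM.1, hM.2.1, hM.2.2⟩
  -- Step 2: the energy cutoff and the cross term, as functions of `R`
  set V : ℝ → ℝ := fun R => (volume {x : PhaseSpace N | P.hamiltonian N x ≤ 4 * R}).toReal with hVdef
  set W : ℝ → ℝ := fun R => 1 + Real.arsinh (2 * M * (1 + V R)) ^ 2 with hWdef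
  have hV0 : ∀ R, 0 ≤ V R := fun R => ENNReal.toReal_nonneg
  have hW1 : ∀ R, 1 ≤ W R := fun R => by
    simp only [hWdef]; nlinarith [sq_nonneg (Real.arsinh (2 * M * (1 + V R)))]
  have h2 : ∀ᶠ R : ℝ in atTop, K₃ * (∫ x, {x | R ≤ P.hamiltonian N x}.indicator ρ x) +
      K₄ * (2 * m₀ + 1) * Real.sqrt (W R / R) ≤ η / 3 + η / 3 := by
    have tA := (tendsto_integral_indicator_le_atTop (μ := volume) hHc.measurable hρi).const_mul K₃
    have tW := tendsto_sqrt_weight_div_atTop hM0 hCv d (V := V) (fun R _ => hV0 R) hvolR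
    have tB := tW.const_mul (K₄ * (2 * m₀ + 1))
    rw [mul_zero] at tA tB
    have hA := tA.eventually (ge_mem_nhds (by positivity : (0:ℝ) < η / 3))
    have hB := tB.eventually (ge_mem_nhds (by positivity : (0:ℝ) < η / 3))
    filter_upwards [hA, hB] with R hRA hRB
    exact add_le_add hRA hRB
  obtain ⟨R, hR2, hRR₀, hR1⟩ : ∃ R, (K₃ * (∫ x, {x | R ≤ P.hamiltonian N x}.indicator ρ x) +
      K₄ * (2 * m₀ + 1) * Real.sqrt (W R / R) ≤ η / 3 + η / 3) ∧ R₀ ≤ R ∧ 1 ≤ R := by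
    obtain ⟨R, hR⟩ := (h2.and ((eventually_ge_atTop R₀).and (eventually_ge_atTop 1))).exists
    exact ⟨R, hR.1, hR.2.1, hR.2.2⟩
  refine ⟨M, R, hMM₀, hRR₀, hM0, hR1, ?_⟩
  -- Step 3: the bound with `δ = 1/(1 + V R)`, `ε = 1/√(W R)`
  have hR0 : 0 < R := by linarith
  have hWR : 0 < W R := by linarith [hW1 R]
  set δ := 1 / (1 + V R) with hδ
  set ε := 1 / Real.sqrt (W R) with hε
  have hδ0 : 0 < δ := by rw [hδ]; exact div_pos one_pos (by linarith [hV0 R])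
  have hsW : 0 < Real.sqrt (W R) := Real.sqrt_pos.2 hWR
  have hε0 : 0 < ε := by rw [hε]; exact div_pos one_pos hsW
  have hb := hbound R M δ ε hR1 hM0 hδ0 hε0
  have hδV : δ * V R ≤ 1 := by
    rw [hδ, div_mul_eq_mul_div, one_mul, div_le_one (by linarith [hV0 R])]
    linarith [hV0 R]
  have hεW : ε * (1 + Real.arsinh (2 * M / δ) ^ 2) = Real.sqrt (W R) := by
    have e1 : 2 * M / δ = 2 * M * (1 + V R) := by rw [hδ]; field_simp
    have e2 : (1 + Real.arsinh (2 * M / δ) ^ 2) = W R := by rw [e1]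
    rw [e2, hε, div_mul_eq_mul_div, one_mul, div_eq_iff hsW.ne', Real.mul_self_sqrt hWR.le]
  have hcross : K₄ / Real.sqrt R * (ε * (1 + Real.arsinh (2 * M / δ) ^ 2) * (m₀ + δ * V R) + m₀ / ε) ≤
      K₄ * (2 * m₀ + 1) * Real.sqrt (W R / R) := by
    rw [hεW]
    have e3 : m₀ / ε = m₀ * Real.sqrt (W R) := by rw [hε]; field_simp
    rw [e3, Real.sqrt_div hWR.le, show K₄ * (2 * m₀ + 1) * (Real.sqrt (W R) / Real.sqrt R) =
      K₄ / Real.sqrt R * ((2 * m₀ + 1) * Real.sqrt (W R)) by ring]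
    refine mul_le_mul_of_nonneg_left ?_ (div_nonneg hK₄ (Real.sqrt_nonneg _))
    nlinarith [mul_le_mul_of_nonneg_left hδV (mul_nonneg hsW.le hm₀0), hsW.le, hm₀0,
      mul_nonneg hsW.le (mul_nonneg hδ0.le (hV0 R))]
  calc _ ≤ K₀ * (∫ x, (if M < ρ x then ρ x else 0)) +
        K₃ * (∫ x, {x | R ≤ P.hamiltonian N x}.indicator ρ x) +
        K₄ / Real.sqrt R * (ε * (1 + Real.arsinh (2 * M / δ) ^ 2) * (m₀ + δ * V R) + m₀ / ε) := hb
    _ ≤ η / 3 + (η / 3 + η / 3) := by linarith [hM1, hR2, hcross]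
    _ = η := by ring

end SiteChain.UniformlyConfining

end Literature.MathematicalPhysics.KineticTheory.HeatConduction
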